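import Summits.HodgeConjecture.HodgeConjecture.Theorems.H413WeilCoinvTwinBridge
import Summits.HodgeConjecture.HodgeCM.Model.AdelicThetaDistributionFin_1
import HarnessLib

/-!
# FLOOR-0 P4, seat S4′(i), junction (J-d) — the model's slot-`0` finite Weil representation `finRepZero` IS the Literature's `finPairRep`, reindexed
# along `finSBReindex e₁` and twisted by the scalar `finCharZero` (the two transport laws `hT`, `hTV` of ★ `exists_holReal_of_transport`)

Cell hodgecm-mathlib (D-0151), FLOOR 0, crux item H413 = stmt-HodgeConjecture-24833; programme P4, line
`Cruxes/H413/Lines/F0_P4AdmissibleOccursInH1.lean`, stub S4′ `stub_T3a_holThetaRealisationOfRallisAt`.  Author F0P4-p01 (g0) (seat (i)); SEAT-i MEMO v2 §5 (J-c)(J-d).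
`--supports stmt-HodgeConjecture-24833 --as helper`.  DEF-FREE; theorems only.

★ `Theorems/H413HolRealOfTransport.exists_holReal_of_transport` (capstone of seat (i)) asks, for the model datum `D` at the line, a linear equivalence
`T : S₁ ≃ₗ 𝒮((𝔸_{L⁺}^∞)³)` along which `D.ωf (1,u) ∘ T = e u • T ∘ ρW₁ u` (`hT`) and `D.ωf (g,1) ∘ T = λ g • T ∘ ρV₁ g` (`hTV`).  At the degenerate seesaw
context `D.ωf = finRepZero …` (★ `Theorems/H413ThetaDistAtLine.distDatumAt_ωf`), and this file reads both laws off ★ `finRepZero_apply` with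
`T := finSBReindex L⁺ e₁`, `(ρV₁, ρW₁)` := the two members of the LITERATURE's `finPairRep[diag(frameD V), diagonal (lineVec a₀), splittingOf hGR₀]`
(★ `Theorems/H413WeilCoinvTwinBridge.finPairRep_twin`), the `U(V)`-member read through the frame congruence `finFrameCongr … = ιVE V` (the pin's own, `rfl`),
and `e u := finCharZero … (1,u)`, `λ g := finCharZero … (g,1)`:

* `finRepZero_inr_finSBReindex` — `finRepZero (1,u) (R v) = finCharZero (1,u) • R (finPairRep[…] (1,u) v)`  (`= hT`);
* `finRepZero_inl_finSBReindex` — `finRepZero (g,1) (R v) = finCharZero (g,1) • R (finPairRep[…] (finFrameCongr g, 1) v)`  (`= hTV`);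
* `finRepZero_finSBReindex` — the joint form at `(g,u)`.

So the knob equation of S4′(i) reads: choose the side's `ν` (★ `sideAt … ν …`, `η₀ = etaT₀ η ν = ν⁻¹∘fst · eta₀ η`) so that `finCharZero … (g,1)` EQUALS the character
`λ` of the line transport (LT, A-p17 (g12)); and the (χ) junction (F0P4-p02) must produce `χ₁` with `D.chiFin χ̃ u = finCharZero … (1,u) · χ₁ u`.
HC_CM is proved only modulo the printed citations until rung 0 closes.

## References
* [GelbartRogawski1991] S. Gelbart, J. Rogawski, Invent. Math. 105 (1991), §3.1 Prop. 3.1.1 p. 455, Remark p. 457.  [Howe1979] R. Howe, Corvallis PSPM 33.1, §3 (see-saw).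
* [Liu2021] Y. Liu, Camb. J. Math. 9 (2021), Def. 4.11, App. D §D.1 Steps 2–3.
* Tree: ★ `HodgeCM/Model/AdelicThetaDistributionFin_1` (`finRepZero`, `finRepZero_apply`, `finCharZero`, `UfZero`), ★ `Theorems/H413WeilCoinvTwinBridge`,
  ★ `Literature/NumberTheory/Weil1964/AdelicMetaplecticReindex` (`finSBReindex`).
-/

set_option autoImplicit false
set_option linter.dupNamespace false

noncomputable section

open NumberField NumberField.mixedEmbedding IsDedekindDomain
open scoped Matrix TensorProduct Classical SchwartzMap
open Literature.NumberTheory.Automorphic Literature.NumberTheory.Weil1964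
open Literature.NumberTheory.GelbartRogawski1991 Literature.NumberTheory.GelbartRogawski1991.UnitaryDualPair
open HodgeCM HodgeCM.Adelic HodgeCM.PerL34 HodgeCM.Model HodgeCM.Model.ArchSideTerm HodgeCM.Model.ThetaDistFin

namespace Summit.HodgeConjecture.HodgeConjecture.Cruxes.H413.ThetaJunction

variable {L : CMField} {ι₁ : L →+* ℂ} (V : HermSpace3 L ι₁) (S : StubTree.SeesawDatum L)
  (hGR : (cmSplittingDatum (L : Type) finProdFinEquiv (frameD V) (frameD_real V) (frameD_ne V) (dW S) (dW_real S)
    (dW_ne S)).CompatibleSplitting)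
  (hGR₀ : (cmSplittingDatum (L : Type) (e₁) (frameD V) (frameD_real V) (frameD_ne V) (lineVec (L : Type) (dW S 0))
    (fun _ => dW_real S 0) (fun _ => dW_ne S 0)).CompatibleSplitting)
  (hGR₁ : (cmSplittingDatum (L : Type) (e₁) (frameD V) (frameD_real V) (frameD_ne V) (lineVec (L : Type) (dW S 1))
    (fun _ => dW_real S 1) (fun _ => dW_ne S 1)).CompatibleSplitting)
  (η₀ : CMAdelic (L : Type) (frameD V) × CMAdelicOne (L : Type) →* ℂˣ)

/-- **the joint transport law**: `finRepZero (g,u) (R v) = finCharZero (g,u) • R (finPairRep[Literature] (finFrameCongr g, u) v)`, `R = finSBReindex e₁`.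
[cite: GelbartRogawski1991, §3.1 Prop. 3.1.1 p. 455; Remark p. 457] -/
theorem finRepZero_finSBReindex (g : ↥V.adelicFin) (u : UfZero S) (v : FinSB (↥(maximalRealSubfield L)) (Fin 3 × Fin 1)) :
    finRepZero V S hGR hGR₀ hGR₁ η₀ (g, u) (finSBReindex (↥(maximalRealSubfield L)) e₁ v) =
      ((finCharZero V S hGR hGR₀ hGR₁ η₀ (g, u) : ℂˣ) : ℂ) •
        finSBReindex (↥(maximalRealSubfield L)) e₁
          (UnitaryDualPair.WeilCoinv.finPairRep _ _ _ _ _ _ _ _ _ _ _ _ _ _ _ _ _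
              (splittingOf_isCompatible _ _ _ _ _ _ _ _ _ _ _ _ _ _ _ _ _ hGR₀)
              (finFrameCongr (L : Type) V.Hm (frameG V) (frameD V) (frame_congr V) g, u) v) := by
  rw [finRepZero_apply, LinearEquiv.symm_apply_apply, finPairRep_twin]

/-- **`hT` of ★ `exists_holReal_of_transport`**: the `U(W₀)(𝔸_f)`-member, `finRepZero (1,u) (R v) = finCharZero (1,u) • R (finPairRep[Literature] (1,u) v)`.
[cite: GelbartRogawski1991, §3.1 Prop. 3.1.1 p. 455; Remark p. 457] -/
theorem finRepZero_inr_finSBReindex (u : UfZero S) (v : FinSB (↥(maximalRealSubfield L)) (Fin 3 × Fin 1)) :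
    finRepZero V S hGR hGR₀ hGR₁ η₀ (1, u) (finSBReindex (↥(maximalRealSubfield L)) e₁ v) =
      ((finCharZero V S hGR hGR₀ hGR₁ η₀ (1, u) : ℂˣ) : ℂ) •
        finSBReindex (↥(maximalRealSubfield L)) e₁
          (UnitaryDualPair.WeilCoinv.finPairRep _ _ _ _ _ _ _ _ _ _ _ _ _ _ _ _ _
              (splittingOf_isCompatible _ _ _ _ _ _ _ _ _ _ _ _ _ _ _ _ _ hGR₀) (1, u) v) := by
  rw [finRepZero_finSBReindex, map_one]

/-- **`hTV` of ★ `exists_holReal_of_transport`**: the `U(V)(𝔸_f)`-member, read through the frame congruence `finFrameCongr … = ιVE V`: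
`finRepZero (g,1) (R v) = finCharZero (g,1) • R (finPairRep[Literature] (finFrameCongr g, 1) v)`. [cite: GelbartRogawski1991, §3.1 Prop. 3.1.1 p. 455; Remark p. 457] -/
theorem finRepZero_inl_finSBReindex (g : ↥V.adelicFin) (v : FinSB (↥(maximalRealSubfield L)) (Fin 3 × Fin 1)) :
    finRepZero V S hGR hGR₀ hGR₁ η₀ (g, 1) (finSBReindex (↥(maximalRealSubfield L)) e₁ v) =
      ((finCharZero V S hGR hGR₀ hGR₁ η₀ (g, 1) : ℂˣ) : ℂ) •
        finSBReindex (↥(maximalRealSubfield L)) e₁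
          (UnitaryDualPair.WeilCoinv.finPairRep _ _ _ _ _ _ _ _ _ _ _ _ _ _ _ _ _
              (splittingOf_isCompatible _ _ _ _ _ _ _ _ _ _ _ _ _ _ _ _ _ hGR₀)
              (finFrameCongr (L : Type) V.Hm (frameG V) (frameD V) (frame_congr V) g, 1) v) :=
  finRepZero_finSBReindex V S hGR hGR₀ hGR₁ η₀ g 1 v

end Summit.HodgeConjecture.HodgeConjecture.Cruxes.H413.ThetaJunction

end
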